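import Summits.CriticalPhenomena.PercolationContinuityZ3.Theorems.PercNearOneGluingNoHeavyPcintBSMBridge
import HarnessLib

/-!
# PCINT lane, PHASE 5 (block-renewal second moment), step 6: the second moment on the keys in play

Cell `prim-pcint`, seat `prim-pcint-1` (gen 14); memo `run/shared/lean/prim/pcint/T-FIBRE-ROUTE.md` §PHASE 5.

On the finite product space over the keys of all `n`-block words (`BSM.allKeys`, parametrised injectively by
`BSM.kedge`; `EdgeExpl.real_eq_sum_wt_of_injective`) the weighted count `Z = Σ_β ν(β) x^{|E(β)|} 𝟙[E(β) open]` has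
`E Z = (Σ ν)^n` when `x p = 1` (`BSM.first_moment`) and `E Z² = A Rloc pc ν x n 0` (`BSM.second_moment`, via
`BSM.card_inter_Eglob`), so by Cauchy–Schwarz `P_p(blockEvent) ≥ 1 / A Rloc pc ν (1/p) n 0` for `Σ ν = 1`
(`BSM.le_real_blockEvent`), and with `BSM.armEvent_of_open`: **`BSM.le_real_armEvent`**,
`1 / A Rloc pc ν (1/p) (m+1) 0 ≤ P_p(0 ⟷ ∂B(0, m))` on `ℤ^{k+t}`.
-/

noncomputable section

namespace Summit.CriticalPhenomena.PercolationContinuityZ3.Theorems.Pcint.BSM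

open Finset OSM AdaptDom EdgeExpl Literature.Probability.Percolation Literature.Probability.LatticeModels

variable {t k np : ℕ}

/-! ### The arm event -/

/-- **The endpoint leaves the ball**: the start of block `m+1` is not in `B(0, m)`. -/
theorem posB_not_mem_ball (pc : Fin np → List (Fin t × Bool)) {m : ℕ} (β : Fin (m + 1) → Blk np k) :
    ι (posB pc β (m + 1)) ∉ DCTQ.ball (zdGraph (k + t)) (0 : Site (k + t)) m := by
  intro hmem
  have h1 := norm_le_of_mem_ball m _ hmem
  have h2 : ((m : ℤ) + 1) ≤ ∑ i, |ι (posB pc β (m + 1)) i| := by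
    rw [Fin.sum_univ_add]
    have ht : ∑ a : Fin k, |ι (posB pc β (m + 1)) (Fin.castAdd t a)| ≥ (m : ℤ) + 1 := by
      have hs := sum_posB_fst pc β (le_refl (m + 1))
      push_cast at hs
      rw [← hs]
      exact sum_le_sum fun a _ => by simpa [ι, Fin.append_left] using le_abs_self ((posB pc β (m + 1)).1 a)
    have hx : 0 ≤ ∑ l : Fin t, |ι (posB pc β (m + 1)) (Fin.natAdd k l)| := sum_nonneg fun _ _ => abs_nonneg _
    linarith
  linarith

/-- An open `(m+1)`-block path realises the arm event of radius `m`. -/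
theorem armEvent_of_open (pc : Fin np → List (Fin t × Bool)) {m : ℕ} {ω : BondConfig (Site (k + t))}
    (hω : ω ⊆ (zdGraph (k + t)).edgeSet) (β : Fin (m + 1) → Blk np k) (hβ : ∀ g ∈ Eglob pc β, gedge g ∈ ω) :
    ω ∈ DCTQ.armEvent (zdGraph (k + t)) (0 : Site (k + t)) m :=
  DCTQ.armEvent_of_pathIn hω (pathIn_blocks pc β hβ (m + 1) le_rfl) (Or.inl (posB_not_mem_ball pc β))

/-! ### The keys in play and the event -/

/-- All keys of all `n`-block words. -/
def allKeys (pc : Fin np → List (Fin t × Bool)) (n : ℕ) : Finset (GKey t k) :=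
  univ.biUnion fun β : Fin n → Blk np k => Eglob pc β

/-- The index type of the keys in play. -/
abbrev KIdx (pc : Fin np → List (Fin t × Bool)) (n : ℕ) := ↥(allKeys (k := k) pc n)

/-- The edge of a key in play. -/
def kedge (pc : Fin np → List (Fin t × Bool)) (n : ℕ) (y : KIdx (k := k) pc n) : Sym2 (Site (k + t)) := gedge y.1

/-- `kedge` is injective. -/
theorem kedge_injective (pc : Fin np → List (Fin t × Bool)) (n : ℕ) :
    Function.Injective (kedge (k := k) pc n) := fun _ _ h => Subtype.ext (gedge_injective h)

/-- The edges in play are lattice edges. -/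
theorem kedge_mem (pc : Fin np → List (Fin t × Bool)) (n : ℕ) (y : KIdx (k := k) pc n) :
    kedge pc n y ∈ (zdGraph (k + t)).edgeSet := gedge_mem _

/-- **Some `n`-block path from the origin is open.** -/
def blockEvent (pc : Fin np → List (Fin t × Bool)) (k n : ℕ) : Set (BondConfig (Site (k + t))) :=
  {ω | ∃ β : Fin n → Blk np k, ∀ g ∈ Eglob pc β, gedge g ∈ ω}

/-- The event is determined by the edges in play. -/
theorem determinedBy_blockEvent (pc : Fin np → List (Fin t × Bool)) (n : ℕ) :
    DeterminedBy (blockEvent pc k n) (Set.range (kedge (k := k) pc n)) := by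
  rw [determinedBy_iff]
  intro ω ω' h
  have key : ∀ (β : Fin n → Blk np k) (g : GKey t k), g ∈ Eglob pc β → (gedge g ∈ ω ↔ gedge g ∈ ω') := by
    intro β g hg
    have hmem : gedge g ∈ Set.range (kedge (k := k) pc n) :=
      ⟨⟨g, mem_biUnion.2 ⟨β, mem_univ _, hg⟩⟩, rfl⟩
    constructor
    · intro hω; have : gedge g ∈ ω ∩ Set.range (kedge (k := k) pc n) := ⟨hω, hmem⟩; rw [h] at this; exact this.1
    · intro hω; have : gedge g ∈ ω' ∩ Set.range (kedge (k := k) pc n) := ⟨hω, hmem⟩; rw [← h] at this; exact this.1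
  simp only [blockEvent, Set.mem_setOf_eq]
  exact exists_congr fun β => forall₂_congr fun g hg => key β g hg

/-! ### Open words and the two moments -/

/-- The keys of `β` as indices in play. -/
def EY (pc : Fin np → List (Fin t × Bool)) (n : ℕ) (β : Fin n → Blk np k) : Finset (KIdx (k := k) pc n) :=
  univ.filter fun y => y.1 ∈ Eglob pc β

/-- `EY β` has as many elements as `Eglob β`. -/
theorem card_EY (pc : Fin np → List (Fin t × Bool)) (n : ℕ) (β : Fin n → Blk np k) :
    (EY (k := k) pc n β).card = (Eglob pc β).card := by
  refine Finset.card_bij (fun y _ => y.1) (fun y hy => (mem_filter.1 hy).2) (fun y _ y' _ h => Subtype.ext h)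
    (fun g hg => ⟨⟨g, mem_biUnion.2 ⟨β, mem_univ _, hg⟩⟩, mem_filter.2 ⟨mem_univ _, hg⟩, rfl⟩)

/-- Shared indices are shared keys. -/
theorem card_EY_inter (pc : Fin np → List (Fin t × Bool)) (n : ℕ) (β β' : Fin n → Blk np k) :
    (EY (k := k) pc n β ∩ EY pc n β').card = (Eglob pc β ∩ Eglob pc β').card := by
  refine Finset.card_bij (fun y _ => y.1) (fun y hy => ?_) (fun y _ y' _ h => Subtype.ext h) (fun g hg => ?_)
  · rw [mem_inter] at hy ⊢; exact ⟨(mem_filter.1 hy.1).2, (mem_filter.1 hy.2).2⟩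
  · rw [mem_inter] at hg
    exact ⟨⟨g, mem_biUnion.2 ⟨β, mem_univ _, hg.1⟩⟩, mem_inter.2 ⟨mem_filter.2 ⟨mem_univ _, hg.1⟩,
      mem_filter.2 ⟨mem_univ _, hg.2⟩⟩, rfl⟩

/-- The configuration of a bit assignment lies in the event iff some word has all its keys set. -/
theorem edgeCfg_mem_iff (pc : Fin np → List (Fin t × Bool)) (n : ℕ) (a : KIdx (k := k) pc n → Bool) :
    edgeCfg (kedge pc n) a ∈ blockEvent pc k n ↔ ∃ β, ∀ y ∈ EY pc n β, a y = true := by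
  simp only [blockEvent, Set.mem_setOf_eq]
  refine exists_congr fun β => ?_
  constructor
  · intro h y hy
    exact (edge_mem_edgeCfg_iff (kedge_injective pc n) (y := y)).1 (h y.1 (mem_filter.1 hy).2)
  · intro h g hg
    exact (edge_mem_edgeCfg_iff (kedge_injective pc n)).2
      (h ⟨g, mem_biUnion.2 ⟨β, mem_univ _, hg⟩⟩ (mem_filter.2 ⟨mem_univ _, hg⟩))

/-- **The weighted number of open words** `Z = Σ_β ν(β) x^{|E(β)|} 𝟙[β open]`. -/
def Z (pc : Fin np → List (Fin t × Bool)) (n : ℕ) (ν : Blk np k → ℝ) (x : ℝ) (a : KIdx (k := k) pc n → Bool) : ℝ :=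
  ∑ β : Fin n → Blk np k, wt' ν β * x ^ (EY pc n β).card * (if ∀ y ∈ EY pc n β, a y = true then 1 else 0)

/-- `Z ≥ 0`. -/
theorem Z_nonneg (pc : Fin np → List (Fin t × Bool)) (n : ℕ) {ν : Blk np k → ℝ} (hν : ∀ b, 0 ≤ ν b) {x : ℝ}
    (hx : 0 ≤ x) (a : KIdx (k := k) pc n → Bool) : 0 ≤ Z pc n ν x a :=
  sum_nonneg fun _ _ => mul_nonneg (mul_nonneg (prod_nonneg fun _ _ => hν _) (pow_nonneg hx _))
    (by split_ifs <;> norm_num)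

/-- `Z = 0` unless some word is open. -/
theorem Z_eq_zero (pc : Fin np → List (Fin t × Bool)) (n : ℕ) (ν : Blk np k → ℝ) (x : ℝ)
    {a : KIdx (k := k) pc n → Bool} (h : ¬ ∃ β, ∀ y ∈ EY pc n β, a y = true) : Z pc n ν x a = 0 :=
  sum_eq_zero fun β _ => by rw [if_neg (not_exists.1 h β), mul_zero]

/-- The total weight of the words. -/
theorem sum_wt' (ν : Blk np k → ℝ) : ∀ n : ℕ, ∑ β : Fin n → Blk np k, wt' ν β = (∑ b : Blk np k, ν b) ^ n
  | 0 => by simp [wt']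
  | n + 1 => by
    rw [sum_cons, pow_succ]
    simp_rw [wt'_cons, ← mul_sum, sum_wt' ν n]
    rw [← sum_mul, mul_comm]

/-- The weight of "all bits of `S` set" is `p^{|S|}` (restated on the keys in play; cf. `OSM.sum_wt_all'`). -/
theorem sum_wt_allK (pc : Fin np → List (Fin t × Bool)) (n : ℕ) (p : ℝ) (S : Finset (KIdx (k := k) pc n)) :
    ∑ a : KIdx (k := k) pc n → Bool, wt p a * (if ∀ y ∈ S, a y = true then (1 : ℝ) else 0) = p ^ S.card := by
  rw [← Finset.sum_filter_of_ne (p := fun a => ∀ y ∈ S, a y = true) (fun a _ h => by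
    by_contra hh; exact h (by rw [if_neg hh, mul_zero]))]
  have : ∑ a ∈ univ.filter (fun a : KIdx (k := k) pc n → Bool => ∀ y ∈ S, a y = true),
      wt p a * (if ∀ y ∈ S, a y = true then (1 : ℝ) else 0) =
      ∑ a ∈ univ.filter (fun a : KIdx (k := k) pc n → Bool => ∀ y ∈ S, a y = (fun _ => true) y), wt p a := by
    refine Finset.sum_congr (by rfl) fun a ha => ?_
    rw [if_pos (mem_filter.1 ha).2, mul_one]
  rw [this]
  have h2 := sum_wt_filter_agree (V := KIdx (k := k) pc n) p S (fun _ => true)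
  rw [Finset.prod_const] at h2
  simp only [bern, if_true] at h2
  convert h2 using 3

/-- The weight of "both words open" is `p^{|E ∪ E'|}`. -/
theorem sum_wt_open_pair (pc : Fin np → List (Fin t × Bool)) (n : ℕ) (p : ℝ) (β β' : Fin n → Blk np k) :
    ∑ a : KIdx (k := k) pc n → Bool, wt p a * ((if ∀ y ∈ EY pc n β, a y = true then (1 : ℝ) else 0) *
      (if ∀ y ∈ EY pc n β', a y = true then (1 : ℝ) else 0)) = p ^ (EY (k := k) pc n β ∪ EY pc n β').card := by
  have : ∀ a : KIdx (k := k) pc n → Bool, ((if ∀ y ∈ EY pc n β, a y = true then (1 : ℝ) else 0) *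
      (if ∀ y ∈ EY pc n β', a y = true then (1 : ℝ) else 0)) =
      (if ∀ y ∈ EY pc n β ∪ EY pc n β', a y = true then (1 : ℝ) else 0) := by
    intro a
    by_cases h1 : ∀ y ∈ EY pc n β, a y = true
    · by_cases h2 : ∀ y ∈ EY pc n β', a y = true
      · rw [if_pos h1, if_pos h2, if_pos (fun y hy => (mem_union.1 hy).elim (h1 y) (h2 y)), one_mul]
      · rw [if_neg h2, mul_zero, if_neg (fun h => h2 fun y hy => h y (mem_union_right _ hy))]
    · rw [if_neg h1, zero_mul, if_neg (fun h => h1 fun y hy => h y (mem_union_left _ hy))]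
  simp_rw [this]
  exact sum_wt_allK pc n p (EY pc n β ∪ EY pc n β')

/-- **First moment**: `Σ_a π_p(a) Z(a) = (Σ ν)^n` when `x p = 1`. -/
theorem first_moment (pc : Fin np → List (Fin t × Bool)) (n : ℕ) (ν : Blk np k → ℝ) {x p : ℝ} (hxp : x * p = 1) :
    ∑ a : KIdx (k := k) pc n → Bool, wt p a * Z pc n ν x a = (∑ b : Blk np k, ν b) ^ n := by
  unfold Z
  simp_rw [mul_sum]
  rw [sum_comm, ← sum_wt']
  refine sum_congr rfl fun β _ => ?_
  calc ∑ a : KIdx (k := k) pc n → Bool, wt p a * (wt' ν β * x ^ (EY pc n β).card *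
        (if ∀ y ∈ EY pc n β, a y = true then (1 : ℝ) else 0))
      = wt' ν β * x ^ (EY pc n β).card *
        ∑ a : KIdx (k := k) pc n → Bool, wt p a * (if ∀ y ∈ EY pc n β, a y = true then (1 : ℝ) else 0) := by
        rw [mul_sum]; exact sum_congr rfl fun a _ => by ring
    _ = wt' ν β := by
        have hw : (∑ a : KIdx (k := k) pc n → Bool, wt p a *
            (if ∀ y ∈ EY pc n β, a y = true then (1 : ℝ) else 0)) = p ^ (EY pc n β).card :=
          sum_wt_allK pc n p (EY pc n β)
        rw [hw, mul_assoc, ← mul_pow, hxp, one_pow, mul_one]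

/-- **Second moment**: `Σ_a π_p(a) Z(a)² = A Rloc pc ν x n 0` when `x p = 1`. -/
theorem second_moment (pc : Fin np → List (Fin t × Bool)) (n : ℕ) (ν : Blk np k → ℝ) {x p : ℝ} (hxp : x * p = 1) :
    ∑ a : KIdx (k := k) pc n → Bool, wt p a * Z pc n ν x a ^ 2 = A (Rloc pc) pc ν x n 0 := by
  -- expand the square
  have hsq : ∀ a : KIdx (k := k) pc n → Bool, wt p a * Z pc n ν x a ^ 2 =
      ∑ β : Fin n → Blk np k, ∑ β' : Fin n → Blk np k, (wt' ν β * wt' ν β' *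
        x ^ ((EY pc n β).card + (EY pc n β').card)) * (wt p a *
          ((if ∀ y ∈ EY pc n β, a y = true then (1 : ℝ) else 0) *
            (if ∀ y ∈ EY pc n β', a y = true then (1 : ℝ) else 0))) := by
    intro a
    rw [Z, sq, sum_mul_sum, mul_sum]
    refine sum_congr rfl fun β _ => ?_
    rw [mul_sum]
    refine sum_congr rfl fun β' _ => ?_
    rw [pow_add]; ring
  simp_rw [hsq]
  rw [sum_comm, A]
  refine sum_congr rfl fun β _ => ?_
  rw [sum_comm]
  refine sum_congr rfl fun β' _ => ?_
  rw [← mul_sum, sum_wt_open_pair, ← card_inter_Eglob, ← card_EY_inter pc n]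
  have hcard : (EY (k := k) pc n β ∪ EY pc n β').card + (EY pc n β ∩ EY pc n β').card =
      (EY pc n β).card + (EY pc n β').card := card_union_add_card_inter _ _
  -- `x^{|E|+|E'|} p^{|E ∪ E'|} = x^{|E ∩ E'|}`
  have key : x ^ ((EY (k := k) pc n β).card + (EY pc n β').card) * p ^ (EY (k := k) pc n β ∪ EY pc n β').card =
      x ^ (EY (k := k) pc n β ∩ EY pc n β').card := by
    rw [← hcard, pow_add, mul_assoc, mul_comm (x ^ _) (p ^ _), ← mul_assoc, ← mul_pow, hxp, one_pow, one_mul]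
  rw [mul_assoc, key]

/-- **The second-moment bound**: if `Σ ν = 1` then `P_p(blockEvent) ≥ 1 / A Rloc pc ν (1/p) n 0`. -/
theorem le_real_blockEvent (pc : Fin np → List (Fin t × Bool)) (n : ℕ) {ν : Blk np k → ℝ} (hν : ∀ b, 0 ≤ ν b)
    (hν1 : ∑ b : Blk np k, ν b = 1) (p : unitInterval) (hp : 0 < (p : ℝ)) :
    1 / A (Rloc pc) pc ν (1 / p) n 0 ≤ (bondPercolation (zdGraph (k + t)) p).real (blockEvent pc k n) := by
  set I : (KIdx (k := k) pc n → Bool) → ℝ := fun a => if ∃ β, ∀ y ∈ EY pc n β, a y = true then 1 else 0 with hI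
  have hreal : (bondPercolation (zdGraph (k + t)) p).real (blockEvent pc k n) =
      ∑ a : KIdx (k := k) pc n → Bool, wt (p : ℝ) a * I a := by
    rw [real_eq_sum_wt_of_injective (zdGraph (k + t)) p (kedge pc n) (kedge_injective pc n) (kedge_mem pc n)
      (determinedBy_blockEvent pc n)]
    refine sum_congr rfl fun a _ => ?_
    congr 1
    by_cases h : ∃ β, ∀ y ∈ EY pc n β, a y = true
    · rw [hI]; dsimp only; rw [if_pos h, Set.indicator_of_mem ((edgeCfg_mem_iff pc n a).2 h)]; rfl
    · rw [hI]; dsimp only; rw [if_neg h, Set.indicator_of_notMem (fun h' => h ((edgeCfg_mem_iff pc n a).1 h'))]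
  rw [hreal]
  have hxp : 1 / (p : ℝ) * p = 1 := by field_simp
  have hw : ∀ a : KIdx (k := k) pc n → Bool, 0 ≤ wt (p : ℝ) a := wt_nonneg p.2.1 p.2.2
  -- Cauchy–Schwarz `(Σ π Z)² ≤ (Σ π Z²)(Σ π I)`
  have hcs := sum_sq_le_sum_mul_sum_of_sq_le_mul (univ : Finset (KIdx (k := k) pc n → Bool))
    (r := fun a => wt (p : ℝ) a * Z pc n ν (1 / p) a) (f := fun a => wt (p : ℝ) a * Z pc n ν (1 / p) a ^ 2)
    (g := fun a => wt (p : ℝ) a * I a) (fun a _ => mul_nonneg (hw a) (sq_nonneg _))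
    (fun a _ => mul_nonneg (hw a) (by rw [hI]; dsimp only; split_ifs <;> norm_num)) (fun a _ => by
      by_cases h : ∃ β, ∀ y ∈ EY pc n β, a y = true
      · rw [hI]; dsimp only; rw [if_pos h]; exact le_of_eq (by ring)
      · rw [Z_eq_zero pc n ν (1 / p) h]; simp)
  rw [first_moment (k := k) pc n ν hxp, second_moment (k := k) pc n ν hxp, hν1, one_pow] at hcs
  have hA : 0 < A (Rloc pc) pc ν (1 / p) n 0 := by
    rcases (A_nonneg (Rloc pc) pc hν (by positivity : (0 : ℝ) ≤ 1 / p) n 0).eq_or_lt with h | h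
    · rw [← h, zero_mul] at hcs; norm_num at hcs
    · exact h
  rw [div_le_iff₀ hA, mul_comm]
  simpa using hcs

/-- **The bridge**: `1 / A Rloc pc ν (1/p) (m+1) 0 ≤ P_p(0 ⟷ ∂B(0, m))` on `ℤ^{k+t}` (for `Σ ν = 1`). -/
theorem le_real_armEvent (pc : Fin np → List (Fin t × Bool)) {ν : Blk np k → ℝ} (hν : ∀ b, 0 ≤ ν b)
    (hν1 : ∑ b : Blk np k, ν b = 1) (p : unitInterval) (hp : 0 < (p : ℝ)) (m : ℕ) :
    1 / A (Rloc pc) pc ν (1 / p) (m + 1) 0 ≤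
      (bondPercolation (zdGraph (k + t)) p).real (DCTQ.armEvent (zdGraph (k + t)) (0 : Site (k + t)) m) :=
  (le_real_blockEvent pc (m + 1) hν hν1 p hp).trans
    (DCT16.real_mono_of_forall_subset_edgeSet (zdGraph (k + t)) p fun _ hω hE => by
      obtain ⟨β, hβ⟩ := hE
      exact armEvent_of_open pc hω β hβ)

end Summit.CriticalPhenomena.PercolationContinuityZ3.Theorems.Pcint.BSM

end
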